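import Literature.NumberTheory.DiophantineGeometry.SchurWeylPlethysm
import Literature.LinearAlgebra.Semilinear.PiTensorProductSemilinear
import HarnessLib

/-!
# The semilinear action of field homomorphisms on tensor powers and Weyl modules

Topic `NumberTheory/DiophantineGeometry` (companion of `SchurWeylPlethysm`: Weyl's construction
`S_μ(kⁿ) = c_μ · (kⁿ)^{⊗d}`). Everything is proved; no named fact.

A ring homomorphism of fields `φ : k → k'` acts coordinatewise on `kⁿ` (`coordSemimap`), hence —
by the semilinear functoriality of `PiTensorProduct`
(`Literature.LinearAlgebra.Semilinear.PiTensorProduct.semimap`) — by a `φ`-SEMILINEAR map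
`(kⁿ)^{⊗d} → (k'ⁿ)^{⊗d}` (`tensorSemimap`), which

* commutes with the action of `S_d` permuting the factors (`tensorSemimap_permTensorRep`) and with
  the action of every element of `k[S_d]` with INTEGER coefficients, in particular with the Young
  symmetrizer `c_μ = a_μ b_μ` (`tensorSemimap_youngSymmetrizer`), so that it maps the Weyl module
  `S_μ(kⁿ)` to `S_μ(k'ⁿ)` (`tensorSemimap_mem_weylModule`, `weylSemimap`);
* intertwines the diagonal action of `g ∈ GL_n(k)` with that of `φ(g) ∈ GL_n(k')`
  (`tensorSemimap_glTensorRep`, `weylSemimap_weylRep`): `φ̃ (g · x) = φ(g) · φ̃ x`.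

For `k = k' = ℂ` and `φ = σ ∈ Aut(ℂ)` this is the `σ`-semilinear automorphism of the algebraic
representation `S_μ(ℂⁿ)` exhibiting its `ℚ`-structure `S_μ(ℚⁿ)`: `σ̃` commutes with `GL_n(ℚ)` (and
with `GL_n(E)` for `σ ∈ Aut(ℂ/E)`), the input for the `Aut(ℂ)`-action on the cohomology of
arithmetic groups with algebraic coefficients (Clozel 1990, §3.5).

## References

* W. Fulton, J. Harris, *Representation Theory*, GTM 129, §6.1 (Weyl's construction) and §15.5.
  [FultonHarrisGTM129]
* L. Clozel, *Motifs et formes automorphes*, in: Automorphic forms, Shimura varieties, and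
  L-functions I (1990), §3.5 (`σ`-conjugation of algebraic coefficient systems). [Clozel1990]
-/

noncomputable section

open scoped BigOperators TensorProduct

namespace Literature.NumberTheory.DiophantineGeometry

open Literature.LinearAlgebra.Semilinear

section Coord

variable {k k' : Type*} [CommSemiring k] [CommSemiring k'] (φ : k →+* k') (ι : Type*)

/-- The coordinatewise action `(vᵢ)ᵢ ↦ (φ vᵢ)ᵢ` of a ring homomorphism on `k^ι`, a `φ`-semilinear
map `k^ι → k'^ι`. [folklore] -/
def coordSemimap : (ι → k) →ₛₗ[φ] (ι → k') where
  toFun v := fun i => φ (v i)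
  map_add' v w := by
    funext i
    simp
  map_smul' c v := by
    funext i
    simp

/-- Unfolding lemma: `coordSemimap φ ι v i = φ (v i)`. [folklore] -/
@[simp]
theorem coordSemimap_apply (v : ι → k) (i : ι) : coordSemimap φ ι v i = φ (v i) :=
  rfl

variable {ι} in
/-- `φ (M v) = φ(M) φ(v)`: the coordinatewise action intertwines multiplication by a matrix `M`
and by `M.map φ` (Mathlib `RingHom.map_mulVec`). [folklore] -/
theorem coordSemimap_mulVec [Fintype ι] (M : Matrix ι ι k) (v : ι → k) :
    coordSemimap φ ι (M.mulVec v) = (M.map φ).mulVec (coordSemimap φ ι v) := by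
  funext i
  rw [coordSemimap_apply, RingHom.map_mulVec]
  rfl

/-- A left inverse `ψ` of `φ` gives a left inverse of the coordinatewise action. [folklore] -/
theorem coordSemimap_coordSemimap {k'' : Type*} [CommSemiring k''] (ψ : k' →+* k'')
    (v : ι → k) : coordSemimap ψ ι (coordSemimap φ ι v) = coordSemimap (ψ.comp φ) ι v :=
  rfl

end Coord

section Tensor

variable {k k' : Type*} [CommRing k] [CommRing k'] (φ : k →+* k') (ι : Type*) (d : ℕ)

/-- **The `φ`-semilinear map `(k^ι)^{⊗d} → (k'^ι)^{⊗d}`, `⊗ vⱼ ↦ ⊗ φ(vⱼ)`** (coordinatewise in each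
factor; `PiTensorProduct.semimap` of the constant family `coordSemimap φ ι`). [folklore] -/
def tensorSemimap : TensorPower k d (ι → k) →ₛₗ[φ] TensorPower k' d (ι → k') :=
  PiTensorProduct.semimap fun _ : Fin d => coordSemimap φ ι

/-- `tensorSemimap` on a pure tensor. [folklore] -/
@[simp]
theorem tensorSemimap_tprod (v : Fin d → ι → k) :
    tensorSemimap φ ι d (PiTensorProduct.tprod k v) =
      PiTensorProduct.tprod k' fun j => coordSemimap φ ι (v j) :=
  PiTensorProduct.semimap_tprod _ v

/-- **`tensorSemimap` commutes with the action of `S_d`** permuting the tensor factors.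
[cite: FultonHarrisGTM129, §6.1] -/
theorem tensorSemimap_permTensorRep (π : Equiv.Perm (Fin d)) (x : TensorPower k d (ι → k)) :
    tensorSemimap φ ι d (permTensorRep k (ι → k) d π x) =
      permTensorRep k' (ι → k') d π (tensorSemimap φ ι d x) :=
  PiTensorProduct.semimap_reindex (coordSemimap φ ι) π x

/-- **`tensorSemimap` intertwines `g^{⊗d}` and `φ(g)^{⊗d}`** for `g ∈ GL(k^ι)`:
`φ̃ (g · x) = φ(g) · φ̃ x`. [cite: FultonHarrisGTM129, §6.1] -/
theorem tensorSemimap_glTensorRep [Fintype ι] [DecidableEq ι] (g : GL ι k)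
    (x : TensorPower k d (ι → k)) :
    tensorSemimap φ ι d (glTensorRep ι k d g x) =
      glTensorRep ι k' d (Matrix.GeneralLinearGroup.map φ g) (tensorSemimap φ ι d x) := by
  have hmap : ((Matrix.GeneralLinearGroup.map φ g : GL ι k') : Matrix ι ι k') =
      (g : Matrix ι ι k).map φ :=
    Matrix.ext fun i j => Matrix.GeneralLinearGroup.map_apply φ i j g
  refine PiTensorProduct.semilinear_ext_apply
    (g := (tensorSemimap φ ι d).comp (glTensorRep ι k d g))
    (g' := (glTensorRep ι k' d (Matrix.GeneralLinearGroup.map φ g)).comp (tensorSemimap φ ι d))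
    (fun v => ?_) x
  rw [LinearMap.comp_apply, LinearMap.comp_apply, glTensorRep_tprod, tensorSemimap,
    PiTensorProduct.semimap_tprod, PiTensorProduct.semimap_tprod, glTensorRep_tprod, hmap]
  congr 1
  funext j
  exact coordSemimap_mulVec φ (g : Matrix ι ι k) (v j)

/-- `tensorSemimap` commutes with the action of a sum `∑_{π ∈ s} π ∈ k[S_d]` (e.g. the row
symmetrizer `a_μ`). [cite: FultonHarrisGTM129, §4.1 (4.1)] -/
theorem tensorSemimap_asAlgebraHom_sum_of (s : Finset (Equiv.Perm (Fin d)))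
    (x : TensorPower k d (ι → k)) :
    tensorSemimap φ ι d ((permTensorRep k (ι → k) d).asAlgebraHom
        (∑ π ∈ s, MonoidAlgebra.of k _ π) x) =
      (permTensorRep k' (ι → k') d).asAlgebraHom (∑ π ∈ s, MonoidAlgebra.of k' _ π)
        (tensorSemimap φ ι d x) := by
  rw [map_sum, map_sum, LinearMap.sum_apply, LinearMap.sum_apply, map_sum]
  refine Finset.sum_congr rfl fun π _ => ?_
  rw [Representation.asAlgebraHom_of, Representation.asAlgebraHom_of, tensorSemimap_permTensorRep]

/-- `tensorSemimap` commutes with the action of a signed sum `∑_{π ∈ s} ε(π) π ∈ k[S_d]` with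
INTEGER coefficients `ε` (e.g. the column antisymmetrizer `b_μ`): `φ` fixes the integers.
[cite: FultonHarrisGTM129, §4.1 (4.2)] -/
theorem tensorSemimap_asAlgebraHom_sum_intCast_smul_of (s : Finset (Equiv.Perm (Fin d)))
    (ε : Equiv.Perm (Fin d) → ℤ) (x : TensorPower k d (ι → k)) :
    tensorSemimap φ ι d ((permTensorRep k (ι → k) d).asAlgebraHom
        (∑ π ∈ s, ((ε π : ℤ) : k) • MonoidAlgebra.of k _ π) x) =
      (permTensorRep k' (ι → k') d).asAlgebraHom (∑ π ∈ s, ((ε π : ℤ) : k') • MonoidAlgebra.of k' _ π)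
        (tensorSemimap φ ι d x) := by
  rw [map_sum, map_sum, LinearMap.sum_apply, LinearMap.sum_apply, map_sum]
  refine Finset.sum_congr rfl fun π _ => ?_
  rw [map_smul, map_smul, Representation.asAlgebraHom_of, Representation.asAlgebraHom_of,
    LinearMap.smul_apply, LinearMap.smul_apply, map_smulₛₗ, map_intCast,
    tensorSemimap_permTensorRep]

end Tensor

section Weyl

variable {k k' : Type*} [Field k] [Field k'] (φ : k →+* k') (ι : Type*) {d : ℕ}

/-- `tensorSemimap` commutes with the row symmetrizer `a_μ`. [cite: FultonHarrisGTM129, §4.1 (4.1)] -/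
theorem tensorSemimap_rowSymmetrizer (μ : Nat.Partition d) (x : TensorPower k d (ι → k)) :
    tensorSemimap φ ι d ((permTensorRep k (ι → k) d).asAlgebraHom (rowSymmetrizer k μ) x) =
      (permTensorRep k' (ι → k') d).asAlgebraHom (rowSymmetrizer k' μ) (tensorSemimap φ ι d x) :=
  tensorSemimap_asAlgebraHom_sum_of φ ι d _ x

/-- `tensorSemimap` commutes with the column antisymmetrizer `b_μ`.
[cite: FultonHarrisGTM129, §4.1 (4.2)] -/
theorem tensorSemimap_colAntisymmetrizer (μ : Nat.Partition d) (x : TensorPower k d (ι → k)) :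
    tensorSemimap φ ι d ((permTensorRep k (ι → k) d).asAlgebraHom (colAntisymmetrizer k μ) x) =
      (permTensorRep k' (ι → k') d).asAlgebraHom (colAntisymmetrizer k' μ)
        (tensorSemimap φ ι d x) :=
  tensorSemimap_asAlgebraHom_sum_intCast_smul_of φ ι d _ (fun π => (Equiv.Perm.sign π : ℤ)) x

/-- **`tensorSemimap` commutes with the Young symmetrizer** `c_μ = a_μ b_μ` (whose coefficients are
integers). [cite: FultonHarrisGTM129, §4.1 (4.3)] -/
theorem tensorSemimap_youngSymmetrizer (μ : Nat.Partition d) (x : TensorPower k d (ι → k)) :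
    tensorSemimap φ ι d ((permTensorRep k (ι → k) d).asAlgebraHom (youngSymmetrizer k μ) x) =
      (permTensorRep k' (ι → k') d).asAlgebraHom (youngSymmetrizer k' μ)
        (tensorSemimap φ ι d x) := by
  rw [youngSymmetrizer, youngSymmetrizer, map_mul, map_mul, Module.End.mul_apply,
    Module.End.mul_apply, tensorSemimap_rowSymmetrizer, tensorSemimap_colAntisymmetrizer]

/-- **`tensorSemimap` maps the Weyl module `S_μ(k^ι) = c_μ · (k^ι)^{⊗d}` into `S_μ(k'^ι)`.**
[cite: FultonHarrisGTM129, §6.1 (Weyl's construction)] -/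
theorem tensorSemimap_mem_weylModule (μ : Nat.Partition d) {x : TensorPower k d (ι → k)}
    (hx : x ∈ weylModule k ι μ) : tensorSemimap φ ι d x ∈ weylModule k' ι μ := by
  obtain ⟨y, rfl⟩ := hx
  exact ⟨tensorSemimap φ ι d y, (tensorSemimap_youngSymmetrizer φ ι μ y).symm⟩

/-- **The `φ`-semilinear map of Weyl modules `S_μ(k^ι) → S_μ(k'^ι)`** induced by a field
homomorphism `φ : k → k'` (restriction of `tensorSemimap`). For `φ = σ ∈ Aut(ℂ)`: the
`σ`-conjugation of `S_μ(ℂⁿ)` fixing its `ℚ`-form `S_μ(ℚⁿ)`. [cite: FultonHarrisGTM129, §6.1 (Weyl's construction)] -/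
def weylSemimap (μ : Nat.Partition d) : weylModule k ι μ →ₛₗ[φ] weylModule k' ι μ :=
  ((tensorSemimap φ ι d).comp (weylModule k ι μ).subtype).codRestrict (weylModule k' ι μ)
    fun x => tensorSemimap_mem_weylModule φ ι μ x.2

/-- The tensor underlying `weylSemimap x` is `tensorSemimap x`. [folklore] -/
@[simp]
theorem coe_weylSemimap (μ : Nat.Partition d) (x : weylModule k ι μ) :
    ((weylSemimap φ ι μ x : weylModule k' ι μ) : TensorPower k' d (ι → k')) =
      tensorSemimap φ ι d x :=
  rfl

/-- **`weylSemimap` intertwines the Weyl representations**: `φ̃ (S_μ(g) x) = S_μ(φ g) (φ̃ x)` for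
`g ∈ GL(k^ι)`. In particular, for `σ ∈ Aut(ℂ/E)` the `σ`-conjugation commutes with `GL_n(E)`.
[cite: FultonHarrisGTM129, §6.1 Thm. 6.3] -/
theorem weylSemimap_weylRep [Fintype ι] [LinearOrder ι] (μ : Nat.Partition d) (g : GL ι k)
    (x : weylModule k ι μ) :
    weylSemimap φ ι μ (weylRep k ι μ g x) =
      weylRep k' ι μ (Matrix.GeneralLinearGroup.map φ g) (weylSemimap φ ι μ x) := by
  refine Subtype.ext ?_
  rw [coe_weylSemimap, coe_weylRep_apply, coe_weylRep_apply, coe_weylSemimap,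
    tensorSemimap_glTensorRep]

/-- **Left inverses**: for `ψ ∘ φ = id` (e.g. `ψ = σ⁻¹`, `φ = σ ∈ Aut(ℂ)`),
`weylSemimap ψ ∘ weylSemimap φ = id`. [folklore] -/
theorem weylSemimap_weylSemimap_of_leftInverse (ψ : k' →+* k) (h : ∀ c, ψ (φ c) = c)
    (μ : Nat.Partition d) (x : weylModule k ι μ) :
    weylSemimap ψ ι μ (weylSemimap φ ι μ x) = x := by
  refine Subtype.ext ?_
  rw [coe_weylSemimap, coe_weylSemimap]
  exact PiTensorProduct.semimap_semimap_of_leftInverse (fun _ : Fin d => coordSemimap φ ι)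
    (fun _ : Fin d => coordSemimap ψ ι) h (fun _ v => funext fun i => h (v i)) (x : TensorPower k d (ι → k))

/-- `weylSemimap φ` is injective as soon as `φ` has a left inverse (always the case for
`φ ∈ Aut(k)`). [folklore] -/
theorem weylSemimap_injective_of_leftInverse (ψ : k' →+* k) (h : ∀ c, ψ (φ c) = c)
    (μ : Nat.Partition d) : Function.Injective (weylSemimap φ ι μ) :=
  Function.LeftInverse.injective (g := weylSemimap ψ ι μ)
    fun x => weylSemimap_weylSemimap_of_leftInverse φ ι ψ h μ x

end Weyl

end Literature.NumberTheory.DiophantineGeometry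

end
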